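import Literature.MathematicalPhysics.QuantumFieldTheory.Balaban1983to89.B11Prop3Model
import HarnessLib

/-!
# Route `UnitScaleTilt`, crux K1 child «MinimiserStabilityRegPr» (stmt-QuantumFields-19200), skeleton v10, stub `stub_existenceMinimalOrbit` (EX), route (α) — **(CH-KNIT v2-tw), STRUCTURE
# PRESERVATION OF PRINT'S CHART REMAINDER `D(A′)`**: the fixed point `D = Dfix C H C₂ A′` of [Balaban1985Variational] (49)–(50) «D = C(A′ − HD)» (r08's selector `B11Prop3Model.Dfix`,
# contraction `B13Contraction113`) lies in EVERY closed set `S ∋ 0` of coarse data that the contraction map `X ↦ C(A′ − HX)` preserves — because the fixed point is UNIQUE in the ball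
# (55) and the contraction can be run inside `S ∩ ball`.  This is the tool by which the (CH5EL-tw)″ display's REALITY conjunct («`X` Hermitian-traceless», print: all fields are
# `𝔤`-valued) and any lattice-symmetry conjunct reduce to preservation rows about the LINEAR∕ANALYTIC letters `H` and `C = CmapTw U₀` (knit v2.5 `Prop7StubEXOfChartPiecesTwL`,
# displayed row `hXtw″`; EX knit ruler's split plan (a))

Cell `ym3-torus`, width seat `ym-ust-19200-w2` (gen 3; KNIT RULER).  THEOREMS ONLY (0 `def`, 0 `sorry`).  Bookkeeping (fixed-point plumbing): nothing here closes the stub; `--supports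
stmt-QuantumFields-19200 --as helper`, count-neutral.  YM₃ on T³ is a ladder rung (R3), not the Clay problem; nothing here claims the stub, the crux, d = 4 or the mass gap.

THE PRINT.  [Balaban1985Variational] p. 285–286: «D = C_j(LʲηA′ − LʲηHD) (50) … We consider configurations A′, X with values in the complexified Lie algebra 𝔤ᶜ (51) … the transformation
(52) … is a contraction for |A′| < ε₃ … thus the equation (50) has exactly one solution D(A′) … |D(A′)| ≦ 4C₂|A′|² (55)»; the reality of print's objects (`𝔤`-valued `A′`, `H` real, `C_j`
mapping `𝔤`-valued configurations to `𝔤`-valued data) makes `D(A′)` `𝔤`-valued — by uniqueness.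

WHAT IS PROVED (sorry-free, no definition; abstract complex Banach spaces `𝒴 ∋ A′`, `𝒳 ∋ X` as in `B11Prop3Model`).  ★ **`Dfix_mem_of_invariant`** — under the contraction hypotheses of
`B11Prop3Model.Dfix_spec` (`QuadAnalytic C C₂ R`, `‖HX‖ ≤ b‖X‖`, `9C₂bε < 1`, `3ε ≤ R`, `‖A′‖ < ε`): for every CLOSED `S ⊆ 𝒳` with `0 ∈ S` and `X ∈ S ⇒ C(A′ − HX) ∈ S`, the selected fixed
point `Dfix C H C₂ A′ ∈ S` (contraction on `S ∩ B̄(0, 4C₂ε²)` via `B13Contraction113.mapsTo_T`∕`lipschitz_T` + `ContractingWith.exists_fixedPoint'`; identification with `Dfix` by the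
uniqueness clause of `exists_unique_fixedPoint` and (55) `Dfix_spec`).  ★ **`Dfix_mem_submodule_of_invariant`** — the same for a closed ℝ-submodule `S` (the shape of the reality row:
`S` = the `i·𝔰𝔲(2)`-valued data, an ℝ-subspace of the complex carrier).

References: T. Bałaban, CMP 102 (1985) 277–309 [Balaban1985Variational] ((47)–(55) pp.285–286, Prop. 3 p.289); CMP 119 (1988) 243–285 [Balaban1988RG2Cluster] ((1.13)–(1.14) p.5, the
tree's `B13Contraction113`).
-/

set_option autoImplicit false

noncomputable section

open Metric Set

namespace Summit.QuantumFields.YangMills.Theorems.Prop7DfixInvariant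

open Literature.MathematicalPhysics.QuantumFieldTheory.Balaban1983to89
open B13Contraction113 (QuadAnalytic exists_unique_fixedPoint mapsTo_T lipschitz_T)
open B11Prop3Model (Dfix Dfix_spec)

variable {𝒴 𝒳 : Type*} [NormedAddCommGroup 𝒴] [NormedSpace ℂ 𝒴] [NormedAddCommGroup 𝒳] [NormedSpace ℂ 𝒳] [CompleteSpace 𝒳]
  {Ct : 𝒴 → 𝒳} {hop : 𝒳 →ₗ[ℂ] 𝒴} {C₂ R b ε : ℝ}

/-- ★ **THE CHART REMAINDER `D(A′)` LIES IN EVERY CLOSED INVARIANT SET OF THE CONTRACTION** ((49)–(55)): if `S ⊆ 𝒳` is closed, contains `0`, and `X ∈ S ⇒ C(A′ − HX) ∈ S`, then — inside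
print's contraction regime `9C₂bε < 1`, `3ε ≤ R`, `‖A′‖ < ε` — the selected solution `Dfix C H C₂ A′` of (50) belongs to `S`: the contraction (52) runs inside the complete set
`S ∩ B̄(0, 4C₂ε²)` and its fixed point there is THE fixed point in the ball (uniqueness, (55)). [cite: Balaban1985Variational, (49)–(55) pp.285–286, Prop. 3 p.289; Balaban1988RG2Cluster, (1.13)–(1.14) p.5] -/
theorem Dfix_mem_of_invariant (hC : QuadAnalytic Ct C₂ R) (hC₂ : 0 ≤ C₂) (hb : 0 ≤ b) (hHop : ∀ X, ‖hop X‖ ≤ b * ‖X‖)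
    (hq : 9 * C₂ * b * ε < 1) (hRC : 3 * ε ≤ R) {A : 𝒴} (hA : ‖A‖ < ε)
    {S : Set 𝒳} (hS : IsClosed S) (h0S : (0 : 𝒳) ∈ S) (hinv : ∀ X ∈ S, Ct (A - hop X) ∈ S) :
    Dfix Ct hop C₂ A ∈ S := by
  have hε : 0 < ε := (norm_nonneg _).trans_lt hA
  have hK0 : 0 ≤ 9 * C₂ * b * ε := by positivity
  have hR2 : 4 * C₂ * b * ε ≤ 1 := by nlinarith
  have hRC2 : 2 * ε ≤ R := by linarith
  -- the contraction on `S ∩ ball`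
  set s : Set 𝒳 := closedBall (0:𝒳) (4 * C₂ * ε ^ 2) ∩ S with hs
  have hmaps0 : MapsTo (fun X => Ct (A - hop X)) (closedBall (0:𝒳) (4 * C₂ * ε ^ 2)) (closedBall (0:𝒳) (4 * C₂ * ε ^ 2)) :=
    mapsTo_T hC hC₂ hb hHop hA hR2 hRC2
  have hmaps : MapsTo (fun X => Ct (A - hop X)) s s := fun X hX => ⟨hmaps0 hX.1, hinv X hX.2⟩
  have hlip : ∀ X₁ ∈ s, ∀ X₂ ∈ s, ‖Ct (A - hop X₁) - Ct (A - hop X₂)‖ ≤ 9 * C₂ * b * ε * ‖X₁ - X₂‖ :=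
    fun X₁ h₁ X₂ h₂ => lipschitz_T hC hC₂ hb hHop hA hR2 hRC h₁.1 h₂.1
  set K : NNReal := ⟨9 * C₂ * b * ε, hK0⟩ with hK
  have hcontr : ContractingWith K (hmaps.restrict _ s s) := by
    refine ⟨?_, ?_⟩
    · change (⟨9 * C₂ * b * ε, hK0⟩ : NNReal) < 1
      exact_mod_cast hq
    · refine LipschitzWith.of_dist_le_mul fun x y => ?_
      change dist (Ct (A - hop (x:𝒳))) (Ct (A - hop (y:𝒳))) ≤ (9 * C₂ * b * ε) * dist (x:𝒳) (y:𝒳)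
      rw [dist_eq_norm, dist_eq_norm]
      exact hlip _ x.2 _ y.2
  have hsc : IsComplete s := (isClosed_closedBall.inter hS).isComplete
  have h0 : (0:𝒳) ∈ s := ⟨by simp only [mem_closedBall, dist_zero_right, norm_zero]; positivity, h0S⟩
  obtain ⟨X, hXs, hfix, -, -⟩ := ContractingWith.exists_fixedPoint' hsc hmaps hcontr h0 (edist_ne_top _ _)
  -- the selected fixed point `Dfix` is in the ball ((55)), hence equals `X` by uniqueness
  obtain ⟨hDb, hDfix⟩ := Dfix_spec (Ct := Ct) (hop := hop) hC hC₂ hb hHop hq hRC hA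
  have hDball : Dfix Ct hop C₂ A ∈ closedBall (0:𝒳) (4 * C₂ * ε ^ 2) := by
    rw [mem_closedBall, dist_zero_right]
    refine hDb.trans ?_
    have h2 : ‖A‖ ^ 2 ≤ ε ^ 2 := pow_le_pow_left₀ (norm_nonneg A) hA.le 2
    nlinarith
  obtain ⟨X₀, -, -, huniq⟩ := exists_unique_fixedPoint (C := Ct) (Hop := hop) hC hC₂ hb hHop hA hq hRC
  have h1 : Dfix Ct hop C₂ A = X₀ := huniq _ hDball hDfix
  have h2 : X = X₀ := huniq _ hXs.1 hfix
  rw [h1, ← h2]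
  exact hXs.2

/-- ★ **THE SAME FOR A CLOSED ℝ-SUBMODULE** (the shape of the reality row: the `i·𝔰𝔲(2)`-valued coarse data form a closed REAL subspace of the complex carrier; print (51): the scheme runs in
`𝔤ᶜ` and real data stay real): if `C(A′ − HX) ∈ S` whenever `X ∈ S`, then `Dfix C H C₂ A′ ∈ S`. [cite: Balaban1985Variational, (51) p.286, (55) p.286, Prop. 3 p.289] -/
theorem Dfix_mem_submodule_of_invariant [Module ℝ 𝒳] (hC : QuadAnalytic Ct C₂ R) (hC₂ : 0 ≤ C₂) (hb : 0 ≤ b) (hHop : ∀ X, ‖hop X‖ ≤ b * ‖X‖)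
    (hq : 9 * C₂ * b * ε < 1) (hRC : 3 * ε ≤ R) {A : 𝒴} (hA : ‖A‖ < ε)
    (S : Submodule ℝ 𝒳) (hS : IsClosed (S : Set 𝒳)) (hinv : ∀ X ∈ S, Ct (A - hop X) ∈ S) :
    Dfix Ct hop C₂ A ∈ S :=
  Dfix_mem_of_invariant hC hC₂ hb hHop hq hRC hA hS S.zero_mem hinv

end Summit.QuantumFields.YangMills.Theorems.Prop7DfixInvariant

end
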